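import Literature.Computability.Complexity.RandomKSatPairPolyBasic
import Literature.Probability.LatticeModels.BinomialEntropy
import Mathlib.Analysis.Calculus.Deriv.MeanValue
import Mathlib.Analysis.SpecialFunctions.Log.Deriv
import Mathlib.Analysis.SpecialFunctions.Log.NegMulLog
import HarnessLib

/-!
# The second moment near overlap `1/2`: `g_r` decays quadratically on `[1/2, 9/10]`

Continuation of `RandomKSatPairPolyBasic.lean` (AP2004 = D. Achlioptas, Y. Peres, J. Amer. Math.
Soc. 17 (2004); arXiv:cs/0305009), §5: Lemma 5 / Corollary 2 — *for `k ≥ 65` and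
`r ≤ 2^k log 2`, `g_r(1/2) > g_r(α)` for all `α ∈ (1/2, 9/10]` and `g_r''(1/2) < 0`*, where
`g_r(α) = f(α)^r/(α^α(1-α)^{1-α})`. AP show that `(30) = r f' + f (log(1-α) - log α)` is decreasing.
We prove the QUANTITATIVE form that the Laplace bound
(`Literature.Combinatorics.sum_choose_mul_pow_le_two_pow`) consumes — a quadratic decay
`g_r(α) ≤ g_r(1/2) e^{-(α-1/2)²}` — by the second-derivative route: with
`ψ = r log F + h` (`h` = entropy, `log g_r = ψ` up to a constant), `ψ'(1/2) = 0` by the balance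
equation (AP (29): `f'(1/2) = 0`) and `ψ'' = r (log F)'' - 1/(α(1-α)) ≤ r F''/F - 4 ≤ -2` as soon
as `r F'' ≤ 2F` (the curvature hypothesis `hcurv`, which holds for `r ≤ 2^k log 2` and large `k`
because `F'' ≤ k²(ε⁴ 2^{k-2} + α^{k-2})`, AP (32), while `F ≥ F(1/2) ≈ 2^k`; it is discharged
in the assembly). Two applications of "non-positive derivative ⇒ antitone"
(`antitoneOn_of_deriv_nonpos`) then give the decay.

## Results (all proved)

* `pairPolyD1_half_eq_zero` — AP (29): `F'(1/2) = 0` under the balance equation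
  `(1+λ)^{k-1}(1-λ) = 1`;
* `log_pairPoly_sub_le_spinRate_sub_sq` — under `hcurv : r F'' ≤ 2 F` on `[1/2, 9/10]`:
  `r (log F(α) - log F(1/2)) ≤ spinRate(2α-1) - (2α-1)²/4` for `α ∈ [1/2, 9/10]`
  (`spinRate(2α-1) = log 2 - h(α)`, `Literature.Probability.LatticeModels.spinRate`);
* `pairPoly_div_rpow_le_exp_near_half` — the same exponentiated:
  `(F(α)/F(1/2))^r ≤ exp(spinRate(2α-1) - (2α-1)²/4)`.
-/

noncomputable section

namespace Literature.Computability.Complexity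

open Set Real Literature.Probability.LatticeModels

namespace RandomKSat

/-- **AP (29)**: `F'(1/2) = 0` under the balance equation — at `α = 1/2`,
`A = (1+λ)²/2`, `B = (1+λ)/2` and `F'(1/2) = k 2^{1-k} ((1+λ)^{k-1}(1-λ) - 1)² `.
[cite: AchlioptasPeres2004, eq. (29) p. 12] -/
theorem pairPolyD1_half_eq_zero {k : ℕ} {lam : ℝ}
    (hbal : (1 + lam) ^ (k - 1) * (1 - lam) = 1) :
    (k : ℝ) * ((1 - lam) ^ 2 * (2 * lam + 1 / 2 * (1 - lam) ^ 2) ^ (k - 1) -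
      2 * (1 - lam) * (lam + 1 / 2 * (1 - lam)) ^ (k - 1) + (1 / 2) ^ (k - 1)) = 0 := by
  have eA : 2 * lam + 1 / 2 * (1 - lam) ^ 2 = (1 + lam) ^ 2 / 2 := by ring
  have eB : lam + 1 / 2 * (1 - lam) = (1 + lam) / 2 := by ring
  rw [eA, eB, div_pow, div_pow, ← pow_mul]
  have e2 : (1 + lam) ^ (2 * (k - 1)) = ((1 + lam) ^ (k - 1)) ^ 2 := by rw [mul_comm, pow_mul]
  rw [e2]
  have key : (1 - lam) ^ 2 * (((1 + lam) ^ (k - 1)) ^ 2 / 2 ^ (k - 1)) -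
      2 * (1 - lam) * ((1 + lam) ^ (k - 1) / 2 ^ (k - 1)) + (1 / 2) ^ (k - 1) =
      ((1 + lam) ^ (k - 1) * (1 - lam) - 1) ^ 2 / 2 ^ (k - 1) := by
    rw [one_div, inv_pow]
    field_simp
    ring
  rw [key, hbal]
  simp

/-- The quadratic decay of `log g_r` on `[1/2, 9/10]` under the curvature hypothesis
`r F'' ≤ 2F`: `r (log F(α) - log F(1/2)) ≤ spinRate(2α - 1) - (2α-1)²/4`. Here
`ψ = r log F + h` satisfies `ψ'(1/2) = 0` (balance, `pairPolyD1_half_eq_zero`) and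
`ψ'' ≤ r F''/F - 1/(α(1-α)) ≤ 2 - 4`, so `ψ + (α - 1/2)²` is antitone.
[cite: AchlioptasPeres2004, Lemma 5 / Corollary 2 (pp. 11–12), quantitative form] -/
theorem log_pairPoly_sub_le_spinRate_sub_sq {k : ℕ} (hk : 2 ≤ k) {lam : ℝ} (hl0 : 0 < lam)
    (hbal : (1 + lam) ^ (k - 1) * (1 - lam) = 1) {r : ℝ} (hr0 : 0 ≤ r)
    (hcurv : ∀ a ∈ Icc (1 / 2 : ℝ) (9 / 10),
      r * ((k : ℝ) * (k - 1 : ℕ) * ((1 - lam) ^ 4 * (2 * lam + a * (1 - lam) ^ 2) ^ (k - 2) -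
        2 * (1 - lam) ^ 2 * (lam + a * (1 - lam)) ^ (k - 2) + a ^ (k - 2))) ≤
        2 * pairPoly k lam a)
    {α : ℝ} (hα : α ∈ Icc (1 / 2 : ℝ) (9 / 10)) :
    r * (Real.log (pairPoly k lam α) - Real.log (pairPoly k lam (1 / 2))) ≤
      spinRate (2 * α - 1) - (2 * α - 1) ^ 2 / 4 := by
  -- notation for F, F', F''
  set F : ℝ → ℝ := fun a => pairPoly k lam a with hF
  set F1 : ℝ → ℝ := fun a => (k : ℝ) * ((1 - lam) ^ 2 * (2 * lam + a * (1 - lam) ^ 2) ^ (k - 1) -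
    2 * (1 - lam) * (lam + a * (1 - lam)) ^ (k - 1) + a ^ (k - 1)) with hF1
  set F2 : ℝ → ℝ := fun a => (k : ℝ) * (k - 1 : ℕ) *
    ((1 - lam) ^ 4 * (2 * lam + a * (1 - lam) ^ 2) ^ (k - 2) -
      2 * (1 - lam) ^ 2 * (lam + a * (1 - lam)) ^ (k - 2) + a ^ (k - 2)) with hF2
  have hFd : ∀ a, HasDerivAt F (F1 a) a := fun a => hasDerivAt_pairPoly k lam a
  have hF1d : ∀ a, HasDerivAt F1 (F2 a) a := fun a => hasDerivAt_deriv_pairPoly k lam a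
  have hne : (1 + lam) ^ k ≠ 1 := by
    have : (1 : ℝ) < (1 + lam) ^ k := one_lt_pow₀ (by linarith) (by omega)
    exact ne_of_gt this
  have hFpos : ∀ a, 1 / 2 ≤ a → 0 < F a := fun a ha => pairPoly_pos_of_half_le hne ha
  -- the domain
  set D : Set ℝ := Icc (1 / 2 : ℝ) (9 / 10) with hD
  have hDconv : Convex ℝ D := convex_Icc _ _
  have hDint : interior D = Ioo (1 / 2 : ℝ) (9 / 10) := interior_Icc
  -- ψ' and its derivative
  set dψ : ℝ → ℝ := fun a => r * (F1 a / F a) - (Real.log a - Real.log (1 - a)) with hdψ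
  set d2ψ : ℝ → ℝ := fun a => r * ((F2 a * F a - F1 a * F1 a) / (F a) ^ 2) -
    (1 / a + 1 / (1 - a)) with hd2ψ
  have hdψ_deriv : ∀ a, 1 / 2 ≤ a → a < 1 → HasDerivAt dψ (d2ψ a) a := by
    intro a ha1 ha2
    have hFa : F a ≠ 0 := (hFpos a ha1).ne'
    have ha0 : a ≠ 0 := by linarith
    have hb0 : 1 - a ≠ 0 := by linarith
    have h1 : HasDerivAt (fun y => F1 y / F y) ((F2 a * F a - F1 a * F1 a) / (F a) ^ 2) a :=
      (hF1d a).div (hFd a) hFa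
    have hl2 : HasDerivAt (fun y => Real.log (1 - y)) (-1 / (1 - a)) a :=
      ((hasDerivAt_id' a).const_sub 1).log hb0
    have h2 : HasDerivAt (fun y => Real.log y - Real.log (1 - y)) (1 / a + 1 / (1 - a)) a := by
      refine ((Real.hasDerivAt_log ha0).fun_sub hl2).congr_deriv ?_
      rw [inv_eq_one_div]; ring
    exact ((h1.const_mul r).fun_sub h2)
  -- ψ and G
  set ψ : ℝ → ℝ := fun a => r * Real.log (F a) - (a * Real.log a + (1 - a) * Real.log (1 - a))
    with hψ
  have hψ_deriv : ∀ a, 1 / 2 ≤ a → a < 1 → HasDerivAt ψ (dψ a) a := by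
    intro a ha1 ha2
    have hFa : F a ≠ 0 := (hFpos a ha1).ne'
    have ha0 : a ≠ 0 := by linarith
    have hb0 : 1 - a ≠ 0 := by linarith
    have h1 : HasDerivAt (fun y => Real.log (F y)) (F1 a / F a) a := (hFd a).log hFa
    have h2 : HasDerivAt (fun y => y * Real.log y) (Real.log a + 1) a := Real.hasDerivAt_mul_log ha0
    have h3 : HasDerivAt (fun y => (1 - y) * Real.log (1 - y)) (-(Real.log (1 - a) + 1)) a := by
      refine (((hasDerivAt_id' a).const_sub 1).fun_mul
        (((hasDerivAt_id' a).const_sub 1).log hb0)).congr_deriv ?_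
      field_simp
      ring
    refine ((h1.const_mul r).fun_sub (h2.fun_add h3)).congr_deriv ?_
    simp only [hdψ]
    ring
  set G : ℝ → ℝ := fun a => ψ a + (a - 1 / 2) ^ 2 with hG
  set dG : ℝ → ℝ := fun a => dψ a + 2 * (a - 1 / 2) with hdG
  have hG_deriv : ∀ a, 1 / 2 ≤ a → a < 1 → HasDerivAt G (dG a) a := by
    intro a ha1 ha2
    refine ((hψ_deriv a ha1 ha2).fun_add (((hasDerivAt_id' a).sub_const (1 / 2)).fun_pow 2)).congr_deriv ?_
    simp only [hdG]
    norm_num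
  have hdG_deriv : ∀ a, 1 / 2 ≤ a → a < 1 → HasDerivAt dG (d2ψ a + 2) a := by
    intro a ha1 ha2
    refine ((hdψ_deriv a ha1 ha2).fun_add (((hasDerivAt_id' a).sub_const (1 / 2)).const_mul 2)).congr_deriv ?_
    ring
  -- the sign of `G'' = ψ'' + 2 ≤ 0` on the interior
  have hd2 : ∀ a ∈ Ioo (1 / 2 : ℝ) (9 / 10), d2ψ a + 2 ≤ 0 := by
    intro a ha
    have ha1 : 1 / 2 < a := ha.1
    have ha2 : a < 9 / 10 := ha.2
    have hFa := hFpos a ha1.le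
    have hc := hcurv a ⟨ha1.le, ha2.le⟩
    -- `r (F2 F - F1²)/F² ≤ r F2 / F ≤ 2`
    have hquot : r * ((F2 a * F a - F1 a * F1 a) / (F a) ^ 2) ≤ 2 := by
      have h1 : r * ((F2 a * F a - F1 a * F1 a) / (F a) ^ 2) ≤ r * (F2 a / F a) := by
        apply mul_le_mul_of_nonneg_left _ hr0
        rw [div_le_div_iff₀ (by positivity) hFa]
        nlinarith [sq_nonneg (F1 a), hFa]
      have h2 : r * (F2 a / F a) ≤ 2 := by
        rw [mul_div_assoc', div_le_iff₀ hFa]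
        exact hc
      linarith
    -- `1/a + 1/(1-a) ≥ 4`
    have hent : 4 ≤ 1 / a + 1 / (1 - a) := by
      have hb : 0 < 1 - a := by linarith
      rw [div_add_div _ _ (by linarith) hb.ne', le_div_iff₀ (by positivity)]
      nlinarith [sq_nonneg (a - 1 / 2)]
    simp only [hd2ψ]
    linarith
  -- Step 1: `dG` is antitone on `D`, hence `dG ≤ dG(1/2) = 0`
  have hdG_cont : ContinuousOn dG D := by
    intro a ha
    exact (hdG_deriv a ha.1 (by linarith [ha.2])).continuousAt.continuousWithinAt
  have hdG_diff : DifferentiableOn ℝ dG (interior D) := by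
    rw [hDint]; intro a ha
    exact (hdG_deriv a ha.1.le (by linarith [ha.2])).differentiableAt.differentiableWithinAt
  have hdG_anti : AntitoneOn dG D := by
    apply antitoneOn_of_deriv_nonpos hDconv hdG_cont hdG_diff
    rw [hDint]; intro a ha
    rw [(hdG_deriv a ha.1.le (by linarith [ha.2])).deriv]
    exact hd2 a ha
  have hdG_half : dG (1 / 2) = 0 := by
    simp only [hdG, hdψ, hF1, hF]
    rw [pairPolyD1_half_eq_zero hbal]
    norm_num
  have hdG_nonpos : ∀ a ∈ D, dG a ≤ 0 := by
    intro a ha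
    have := hdG_anti ⟨le_rfl, by norm_num⟩ ha ha.1
    rwa [hdG_half] at this
  -- Step 2: `G` is antitone on `D`, hence `G(α) ≤ G(1/2)`
  have hG_cont : ContinuousOn G D := by
    intro a ha
    exact (hG_deriv a ha.1 (by linarith [ha.2])).continuousAt.continuousWithinAt
  have hG_diff : DifferentiableOn ℝ G (interior D) := by
    rw [hDint]; intro a ha
    exact (hG_deriv a ha.1.le (by linarith [ha.2])).differentiableAt.differentiableWithinAt
  have hG_anti : AntitoneOn G D := by
    apply antitoneOn_of_deriv_nonpos hDconv hG_cont hG_diff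
    rw [hDint]; intro a ha
    rw [(hG_deriv a ha.1.le (by linarith [ha.2])).deriv]
    exact hdG_nonpos a ⟨ha.1.le, ha.2.le⟩
  have hGle : G α ≤ G (1 / 2) := hG_anti ⟨le_rfl, by norm_num⟩ hα hα.1
  -- unfold: `G(α) ≤ G(1/2)` is the claim
  simp only [hG, hψ, hF] at hGle
  have hsr : spinRate (2 * α - 1) = Real.log 2 - Real.binEntropy α := by
    rw [spinRate_eq_log_two_sub_binEntropy]; congr 1; ring
  rw [hsr, Real.binEntropy_eq_negMulLog_add_negMulLog_one_sub, Real.negMulLog, Real.negMulLog]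
  have hlog_half : (1 / 2 : ℝ) * Real.log (1 / 2) + (1 - 1 / 2) * Real.log (1 - 1 / 2) =
      -Real.log 2 := by
    have : (1 : ℝ) - 1 / 2 = 1 / 2 := by norm_num
    rw [this, one_div, Real.log_inv]; ring
  rw [hlog_half] at hGle
  nlinarith [hGle]

/-- **Quadratic decay near `1/2`, exponentiated**: under the hypotheses of
`log_pairPoly_sub_le_spinRate_sub_sq`, `(F(α)/F(1/2))^r ≤ exp(spinRate(2α-1) - (2α-1)²/4)` for
`α ∈ [1/2, 9/10]` — the form consumed by `Literature.Combinatorics.sum_choose_mul_pow_le_two_pow`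
with `κ = 1/4`. [cite: AchlioptasPeres2004, Corollary 2 (p. 12), quantitative form] -/
theorem pairPoly_div_rpow_le_exp_near_half {k : ℕ} (hk : 2 ≤ k) {lam : ℝ} (hl0 : 0 < lam)
    (hbal : (1 + lam) ^ (k - 1) * (1 - lam) = 1) {r : ℝ} (hr0 : 0 ≤ r)
    (hcurv : ∀ a ∈ Icc (1 / 2 : ℝ) (9 / 10),
      r * ((k : ℝ) * (k - 1 : ℕ) * ((1 - lam) ^ 4 * (2 * lam + a * (1 - lam) ^ 2) ^ (k - 2) -
        2 * (1 - lam) ^ 2 * (lam + a * (1 - lam)) ^ (k - 2) + a ^ (k - 2))) ≤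
        2 * pairPoly k lam a)
    {α : ℝ} (hα : α ∈ Icc (1 / 2 : ℝ) (9 / 10)) :
    (pairPoly k lam α / pairPoly k lam (1 / 2)) ^ r ≤
      Real.exp (spinRate (2 * α - 1) - (2 * α - 1) ^ 2 / 4) := by
  have hne : (1 + lam) ^ k ≠ 1 := by
    have : (1 : ℝ) < (1 + lam) ^ k := one_lt_pow₀ (by linarith) (by omega)
    exact ne_of_gt this
  have hFα : 0 < pairPoly k lam α := pairPoly_pos_of_half_le hne hα.1
  have hFh : 0 < pairPoly k lam (1 / 2) := pairPoly_pos_of_half_le hne le_rfl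
  have h := log_pairPoly_sub_le_spinRate_sub_sq hk hl0 hbal hr0 hcurv hα
  rw [Real.rpow_def_of_pos (div_pos hFα hFh), Real.exp_le_exp, Real.log_div hFα.ne' hFh.ne']
  linarith

end RandomKSat

end Literature.Computability.Complexity

end
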